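import Literature.IUT.LogVolume.MultiradialRegion
import HarnessLib

/-!
# The fork at [IUTchIII] Corollary 3.12, L-DH level (c312-3), III-a: the valuation line — a model of the
# Dupuy–Hilado packet interface WITH indeterminacies over any number field

Record-only file (D-0012) of the abc-iut cell (seat abc-iut-c312-3); TAKES NO SIDE. Support for the VACUITY
AUDIT of the L-DH hypothesis structures (`LDHWitness`): an `IndPacketModel F`
(`Literature.IUT.LogVolume.MultiradialRegion`) over ANY number field `F` in which every interface axiom
— monotone normalised log-measure, `log μ̄(O) = 0`, the action-through-the-last-factor formula (3.7) with
(3.4), the (Ind1) transport preserving admissibility/log-measure/lattice, the (Ind2) action preserving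
them, a hull — holds by a one-line computation:

* `valLine F` — every summand `X_{v⃗} := ℝ` (think: minus the normalised log of the absolute value on the
  last tensor factor), admissible sets = rays `[r, ∞)`, `log μ̄([r,∞)) := −r`, integral structure and
  log-shell `[0,∞)`, local scalars `Λ_v := ℝ` with `ord_v = id`, peel action = translation by
  `ord_v(a)·ln|κ(v)|/n_v`, (Ind1) transport = identity, (Ind2) trivial, hull = identity. It is the
  rank-one shadow of Dupuy–Hilado's `𝕃` in which `t·O_{v⃗} ↦ [ord(t)·ln|κ|/n, ∞)`;
* `ValLine.region_succ`/`region_of_not`/`region_eq_Ici`: the regions `O_𝕃(−div t)` of the valuation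
  line are rays with endpoint `ord(t_{j,v_j})·ln|κ(v_j)|/n_{v_j}` (or `0` outside `𝕃`'s degrees).

[cite: DupuyHilado2025, §3.4, §3.7, §3.9, §4.7–4.12] Deliberately NOT here: any `p`-adic content (a model
from Mathlib's completions is `Literature.IUT.LogVolume.completionModel`); the witnesses themselves
(`LDHWitness`); any judgement.
-/

noncomputable section

open Set Finset

namespace Summit.ABC.IUTFork

open Literature.IUT.LogVolume NumberField IsDedekindDomain
open scoped Pointwise

variable (F : Type) [Field F] [NumberField F]

/-! ## 1. The valuation line -/

namespace ValLine

/-- The trivial action of the one-element group on `ℝ` (the (Ind2) slot of the valuation line). [folklore] -/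
@[reducible] def trivAction : MulAction Unit ℝ where
  smul _ x := x
  one_smul _ := rfl
  mul_smul _ _ _ := rfl

/-- Rays `[r, ∞)` — the admissible sets of the valuation line. [folklore] -/
def IsRay (A : Set ℝ) : Prop := ∃ r : ℝ, A = Set.Ici r

/-- `log μ̄([r, ∞)) := −r` (as `−inf A`). [folklore] -/
def rayLog (A : Set ℝ) : ℝ := -sInf A

/-- `log μ̄([r,∞)) = −r`. [folklore] -/
theorem rayLog_Ici (r : ℝ) : rayLog (Set.Ici r) = -r := by rw [rayLog, csInf_Ici]

/-- `log μ̄` is monotone on rays. [folklore] -/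
theorem rayLog_mono {A B : Set ℝ} (hA : IsRay A) (hB : IsRay B) (h : A ⊆ B) : rayLog A ≤ rayLog B := by
  obtain ⟨a, rfl⟩ := hA; obtain ⟨b, rfl⟩ := hB
  rw [rayLog_Ici, rayLog_Ici, neg_le_neg_iff]
  exact Set.Ici_subset_Ici.mp h

/-- Translation by `d` maps `[r,∞)` onto `[r+d,∞)`. [folklore] -/
theorem image_add_Ici (d r : ℝ) : (fun x : ℝ => x + d) '' Set.Ici r = Set.Ici (r + d) := Set.image_add_const_Ici d r

/-- The scaling constant `ln|κ(v)|/n_v` of a place. [cite: DupuyHilado2025, §3.4] -/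
def c {p : ℕ} (v : placesOver F p) : ℝ := logNorm F v.1 / localDegree F v.1

/-- `ln|κ(v)|/n_v > 0`. [folklore] -/
theorem c_pos {p : ℕ} (v : placesOver F p) : 0 < c F v :=
  div_pos (logNorm_pos F v.1) (by exact_mod_cast localDegree_pos F v.1)

end ValLine

open ValLine in
/-- **The valuation line**: an `IndPacketModel` over any number field in which every axiom of the
Dupuy–Hilado interface holds by a one-line computation on rays (see the module docstring).
[cite: DupuyHilado2025, §3.4, §3.7, §4.7–4.12] -/
@[reducible] def valLine : IndPacketModel F where
  X _ _ _ := ℝ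
  adm A := IsRay A
  logμ A := rayLog A
  logμ_mono hA hB hAB := rayLog_mono hA hB hAB
  O _ _ _ := Set.Ici 0
  O_adm _ _ _ := ⟨0, rfl⟩
  logμ_O _ _ _ := by simp [rayLog_Ici]
  Λ _ _ := ℝ
  ordv a := a
  peel {p j e} a := Equiv.addRight (a * c F (e (Fin.last j)))
  peel_adm {p j e} a U hU := by
    obtain ⟨r, rfl⟩ := hU
    exact ⟨r + a * c F (e (Fin.last j)), by simp [Equiv.coe_addRight]⟩
  logμ_peel {p j e} a U hU := by
    obtain ⟨r, rfl⟩ := hU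
    simp only [Equiv.coe_addRight, image_add_Ici, rayLog_Ici, c]
    ring
  shell _ _ _ := Set.Ici 0
  shell_adm _ _ _ := ⟨0, rfl⟩
  perm _ _ := Equiv.refl ℝ
  perm_one _ _ := rfl
  perm_adm _ _ U hU := by simpa using hU
  logμ_perm _ _ U _ := by simp
  perm_shell _ _ := by simp
  G₂ _ _ _ := Unit
  group₂ _ _ _ := inferInstance
  action₂ _ _ _ := trivAction
  smul_adm g U hU := by
    show IsRay ((fun x : ℝ => x) '' U)
    rwa [Set.image_id']
  logμ_smul g U hU := by
    show rayLog ((fun x : ℝ => x) '' U) = rayLog U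
    rw [Set.image_id']
  smul_shell g := by
    show ((fun x : ℝ => x) '' Set.Ici (0 : ℝ)) = Set.Ici 0
    rw [Set.image_id']
  hullLoc _ _ _ := ClosureOperator.id (Set ℝ)

namespace ValLine

/-- In the valuation line the region `O_𝕃(−div t)` in a degree `j = i+1` of `𝕃` is the ray
`[ord(t_{j,v_j})·ln|κ(v_j)|/n_{v_j}, ∞)`. [cite: DupuyHilado2025, §3.9] -/
theorem region_succ {lstar : ℕ} (t : (valLine F).LgpIdele lstar) (i : Fin lstar) (p : ℕ)
    (e : Fin ((i : ℕ) + 1 + 1) → placesOver F p) :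
    (valLine F).region t p ((i : ℕ) + 1) e = Set.Ici (t i p (e (Fin.last _)) * c F (e (Fin.last _))) := by
  rw [(valLine F).region_succ t i p e]
  show (Equiv.addRight _) '' Set.Ici (0 : ℝ) = _
  simp [Equiv.coe_addRight]

/-- … and `O = [0,∞)` in the other degrees. [cite: DupuyHilado2025, §3.9] -/
theorem region_of_not {lstar : ℕ} (t : (valLine F).LgpIdele lstar) (p j : ℕ)
    (e : Fin (j + 1) → placesOver F p) (h : ¬ (0 < j ∧ j - 1 < lstar)) :
    (valLine F).region t p j e = Set.Ici 0 := by
  simp only [PacketModel.region, dif_neg h]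

/-- Every region `O_𝕃(−div t)` component is a ray `[b,∞)` with `b = 0` or `b = ord·c`. [folklore] -/
theorem region_eq_Ici {lstar : ℕ} (t : (valLine F).LgpIdele lstar) (p j : ℕ)
    (e : Fin (j + 1) → placesOver F p) :
    ∃ b : ℝ, (valLine F).region t p j e = Set.Ici b ∧
      (b = 0 ∨ ∃ h : 0 < j ∧ j - 1 < lstar, b = t ⟨j - 1, h.2⟩ p (e (Fin.last j)) * c F (e (Fin.last j))) := by
  by_cases h : 0 < j ∧ j - 1 < lstar
  · refine ⟨_, ?_, Or.inr ⟨h, rfl⟩⟩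
    simp only [PacketModel.region, dif_pos h]
    show (Equiv.addRight _) '' Set.Ici (0 : ℝ) = _
    simp [Equiv.coe_addRight]
  · exact ⟨0, region_of_not F t p j e h, Or.inl rfl⟩

end ValLine


end Summit.ABC.IUTFork

end
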